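import Literature.IUT.HodgeTheaters.InitialThetaDataThm19Functorial
import HarnessLib

/-!
# `Thm_1_9'` — CONSISTENCY OF THE EQUIVARIANCE CLAUSE WITH THE TYPED FUNCTORIALITY LAWS, and the laws of the named action
# (proof-only rider to GB-17; abc-iut cell, L4 lineage / ERRATA-L5 X-143 owner, seat abc-iut-c312-2 gen 13)

S. Mochizuki, *Topics in Absolute Anabelian Geometry III*, J. Math. Sci. Univ. Tokyo **22** (2015), Thm. 1.9 pp. 37–38
[cite: MochizukiAbsTopIII2015, Thm 1.9 pp.37-38]; S. Mochizuki, *Inter-universal Teichmüller theory I*, Ex. 5.1 (i) p. 123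
([IUTchI] Ex 5.1 (i) p.123) [claim: Mochizuki2012, status: disputed].

WHY.  `AbsTopIII.Thm_1_9' M ρ` (★ `ReconstructionThm19Functorial`, GB-17) asks a witnessing `NFPortionAlgorithm A` for a comparison `φ`
with `φ ∘ A.map (innerIso g) = ρ.act i g ∘ φ`.  The algorithm's TYPED functoriality laws (`map_id : (A.map (Iso.refl E)).funEquiv = refl`,
`map_comp : (A.map (e ≪≫ f)).funEquiv = (A.map e).funEquiv.trans (A.map f).funEquiv`, `Reconstruction.lean` :138–141) then FORCE laws on
the model-side recorded action: since `innerIso 1 = Iso.refl E` and `innerIso (h * g) = innerIso g ≪≫ innerIso h` (proved here), any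
witness makes `ρ.act i 1` the identity and `ρ.act i (h * g) = ρ.act i h ∘ ρ.act i g` — so a datum `ρ` violating these laws would make
`Thm_1_9' M ρ` FALSE for reasons that have nothing to do with anabelian geometry.  THIS FILE proves (1) those two NECESSARY CONDITIONS
generically (`act_one_of_innerEquivariantAt`, `act_mul_of_innerEquivariantAt`) and (2) that the NAMED action of the binder of record
`D.Thm19' G` — the coefficient action `ratFuncMapCoeffs (D.augGF g)` at `C_F` — SATISFIES them (`nfGaloisAction_act_one`,
`nfGaloisAction_act_mul`), i.e. the binder of record is NOT refutable by the functoriality laws alone.  (It is NOT thereby inhabited: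
`Thm19' G` stays a HYPOTHESIS — a strengthened [AbsTopIII] Thm 1.9 typed by name.)

PROOF-ONLY: no definition of record, no instance, no notation, no axiom, no `sorry`; nothing landed is edited or restated.  No side is taken
on [IUTchIII] Cor. 3.12; nothing here asserts that abc is proved or refuted; typed ≠ inhabited ≠ proved-in-print.
-/

noncomputable section

universe u

open CategoryTheory

namespace Literature.IUT.HodgeTheaters

open Literature.AnabelianGeometry.AbsoluteAnabelian
open Literature.AnabelianGeometry.AbsoluteAnabelian.AbsTopIII
open Literature.FieldTheory.FunctionField

namespace InitialThetaData

namespace Thm19Laws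

/-! ### §1. `innerIso` is a monoid action by isomorphisms of the extension (generic; stated here, in the consumer's namespace) -/

/-- `innerIso 1 = Iso.refl E` (conjugation by `1`). [cite: MochizukiAbsTopIII2015, Thm 1.9 p.38] -/
theorem innerIso_one (E : FundamentalExtension.{u}) : E.innerIso 1 = Iso.refl E := by
  refine Iso.ext (FundamentalExtension.Hom.ext ?_ ?_)
  · exact ContinuousMonoidHom.ext fun x => by
      change (1 : E.arith) * x * 1⁻¹ = x
      group
  · exact ContinuousMonoidHom.ext fun x => by
      change E.aug 1 * x * (E.aug 1)⁻¹ = x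
      rw [map_one]; group

/-- `innerIso (h * g) = innerIso g ≪≫ innerIso h` (conjugation by `h * g` = conjugation by `g`, then by `h`; diagrammatic composition).
[cite: MochizukiAbsTopIII2015, Thm 1.9 p.38] -/
theorem innerIso_mul (E : FundamentalExtension.{u}) (h g : E.arith) :
    E.innerIso (h * g) = E.innerIso g ≪≫ E.innerIso h := by
  refine Iso.ext (FundamentalExtension.Hom.ext ?_ ?_)
  · exact ContinuousMonoidHom.ext fun x => by
      change h * g * x * (h * g)⁻¹ = h * (g * x * g⁻¹) * h⁻¹
      group
  · exact ContinuousMonoidHom.ext fun x => by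
      change E.aug (h * g) * x * (E.aug (h * g))⁻¹ = E.aug h * (E.aug g * x * (E.aug g)⁻¹) * (E.aug h)⁻¹
      rw [map_mul]; group

/-! ### §2. Necessary conditions on the recorded action forced by ANY witness of the clause (generic) -/

variable {M : CurveModel.{u}} {ρ : M.NFGaloisAction} {A : NFPortionAlgorithm.{u}} {i : ρ.ι}

/-- **A witness forces `ρ.act i 1 = id`** (from `map_id` and `innerIso 1 = refl`). [cite: MochizukiAbsTopIII2015, Thm 1.9 p.38] -/
theorem act_one_of_innerEquivariantAt (h : A.InnerEquivariantAt M ρ i) (f : M.NFFunctionField (ρ.curve i)) :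
    ρ.act i 1 f = f := by
  obtain ⟨φ, hφ⟩ := h
  have key := hφ 1 (φ.symm f)
  rw [innerIso_one, A.map_id, RingEquiv.refl_apply, RingEquiv.apply_symm_apply] at key
  exact key.symm

/-- **A witness forces multiplicativity `ρ.act i (h * g) = ρ.act i h ∘ ρ.act i g`** (from `map_comp` and `innerIso_mul`).
[cite: MochizukiAbsTopIII2015, Thm 1.9 p.38] -/
theorem act_mul_of_innerEquivariantAt (hw : A.InnerEquivariantAt M ρ i) (h g : (M.ext (ρ.curve i)).arith)
    (f : M.NFFunctionField (ρ.curve i)) : ρ.act i (h * g) f = ρ.act i h (ρ.act i g f) := by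
  obtain ⟨φ, hφ⟩ := hw
  have key := hφ (h * g) (φ.symm f)
  rw [innerIso_mul, A.map_comp, RingEquiv.trans_apply, hφ h, hφ g, RingEquiv.apply_symm_apply] at key
  exact key.symm

/-- Hence: a datum whose recorded action is NOT unital at a recorded Thm-1.9 input curve makes `Thm_1_9'` FALSE for a reason unrelated to
anabelian geometry — the law to check on any proposed `ρ`. [cite: MochizukiAbsTopIII2015, Thm 1.9 p.38] -/
theorem not_thm_1_9'_of_act_one_ne (i : ρ.ι) (hin : M.IsThm19Input (ρ.curve i))
    (hbad : ∃ f : M.NFFunctionField (ρ.curve i), ρ.act i 1 f ≠ f) : ¬ Thm_1_9' M ρ := by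
  rintro ⟨A, hA⟩
  obtain ⟨f, hf⟩ := hbad
  exact hf (act_one_of_innerEquivariantAt (hA.2 i hin) f)

/-! ### §3. The NAMED action of `D.Thm19' G` satisfies the forced laws (so the binder of record is not refutable by them) -/

/-- `ratFuncMapCoeffs (RingHom.id K) = RingHom.id (RatFunc K)` (extension of constants along the identity is the identity; the
`ψ ∘ φ` functoriality of `ratFuncMapCoeffs_comp` at the empty composite). [cite: ChevalleyAlgebraicFunctions1951, Ch. VI §6 Thm 11] -/
theorem ratFuncMapCoeffs_id (K : Type u) [Field K] : ratFuncMapCoeffs (RingHom.id K) = RingHom.id (RatFunc K) := by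
  refine IsLocalization.ringHom_ext (nonZeroDivisors (Polynomial K)) (RingHom.ext fun P => ?_)
  rw [RingHom.comp_apply, RingHom.comp_apply, ratFuncMapCoeffs_algebraMap, Polynomial.map_id, RingHom.id_apply]

variable {F K Fbar : Type u} [Field F] [NumberField F] [Field K] [NumberField K] [Algebra F K]
  [Field Fbar] [Algebra F Fbar] [Algebra K Fbar] {E : WeierstrassCurve F} [E.IsElliptic] {l : ℕ}
  {Pb : BadPlacePredicates K} (D : InitialThetaData F K Fbar E l Pb)

/-- **The named action is unital**: `(D.nfGaloisAction G).act i 1 = id` (`augGF 1 = 1`, extension of constants along the identity).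
([IUTchI] Ex 5.1 (i) p.123) [claim: Mochizuki2012, status: disputed] -/
theorem nfGaloisAction_act_one (G : D.LocalThetaGeometry) (i : (D.nfGaloisAction G).ι)
    (f : (D.nfCurveModelLocal G).NFFunctionField ((D.nfGaloisAction G).curve i)) :
    (D.nfGaloisAction G).act i 1 f = f := by
  change ratFuncMapCoeffs ((D.augGF 1 : Fbar ≃ₐ[F] Fbar) : Fbar →+* Fbar) f = f
  have h1 : ((D.augGF 1 : Fbar ≃ₐ[F] Fbar) : Fbar →+* Fbar) = RingHom.id Fbar := by
    rw [map_one]; rfl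
  rw [h1, ratFuncMapCoeffs_id, RingHom.id_apply]

/-- **The named action is multiplicative**: `act i (h * g) = act i h ∘ act i g` (`augGF` is a homomorphism; `ratFuncMapCoeffs_comp`).
([IUTchI] Ex 5.1 (i) p.123) [claim: Mochizuki2012, status: disputed] -/
theorem nfGaloisAction_act_mul (G : D.LocalThetaGeometry) (i : (D.nfGaloisAction G).ι) (h g : D.geom.extF.arith)
    (f : (D.nfCurveModelLocal G).NFFunctionField ((D.nfGaloisAction G).curve i)) :
    (D.nfGaloisAction G).act i (h * g) f = (D.nfGaloisAction G).act i h ((D.nfGaloisAction G).act i g f) := by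
  change ratFuncMapCoeffs ((D.augGF (h * g) : Fbar ≃ₐ[F] Fbar) : Fbar →+* Fbar) f =
    ratFuncMapCoeffs ((D.augGF h : Fbar ≃ₐ[F] Fbar) : Fbar →+* Fbar) (ratFuncMapCoeffs ((D.augGF g : Fbar ≃ₐ[F] Fbar) : Fbar →+* Fbar) f)
  have hcomp : ((D.augGF (h * g) : Fbar ≃ₐ[F] Fbar) : Fbar →+* Fbar) =
      ((D.augGF h : Fbar ≃ₐ[F] Fbar) : Fbar →+* Fbar).comp ((D.augGF g : Fbar ≃ₐ[F] Fbar) : Fbar →+* Fbar) := by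
    rw [map_mul]; rfl
  rw [hcomp, ← ratFuncMapCoeffs_ratFuncMapCoeffs]

/-- **Summary — the binder of record passes the law check**: the two necessary conditions that ANY witness of `D.Thm19' G` imposes on the
recorded action hold for the named action by the two lemmas above; equivalently, `not_thm_1_9'_of_act_one_ne` does NOT fire at the named
pair.  `Thm19' G` is thereby neither inhabited nor refuted — it stays a HYPOTHESIS. ([IUTchI] Ex 5.1 (i) p.123)
[claim: Mochizuki2012, status: disputed] -/
theorem nfGaloisAction_lawful (G : D.LocalThetaGeometry) (i : (D.nfGaloisAction G).ι) :
    (∀ f, (D.nfGaloisAction G).act i 1 f = f) ∧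
      ∀ (h g : D.geom.extF.arith) f,
        (D.nfGaloisAction G).act i (h * g) f = (D.nfGaloisAction G).act i h ((D.nfGaloisAction G).act i g f) :=
  ⟨nfGaloisAction_act_one D G i, nfGaloisAction_act_mul D G i⟩

end Thm19Laws

end InitialThetaData

end Literature.IUT.HodgeTheaters

end
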